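import Mathlib.Topology.Algebra.OpenSubgroup
import Mathlib.Topology.Algebra.ClopenNhdofOne
import Mathlib.Topology.Algebra.ContinuousMonoidHom
import Mathlib.Topology.Algebra.Group.Quotient
import Mathlib.GroupTheory.QuotientGroup.Basic
import Mathlib.GroupTheory.Coset.Basic
import Mathlib.CategoryTheory.Action.Concrete
import Mathlib.CategoryTheory.ObjectProperty.FullSubcategory
import Literature.AlgebraicGeometry.Frobenioids.Categories
import HarnessLib

/-!
# Semi-graphs of anabelioids, §3 (part 1): tempered groups and the category `B^temp(Π)`

Mochizuki, *Semi-graphs of anabelioids*, Publ. RIMS **42** (2006) 221–322, §3 "The Tempered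
Fundamental Group", author's manuscript pp. 33–36 [cite: MochizukiSemiAnbd2006, §3 pp.33-36].
This file types the *group-theoretic* layer of §3 on which everything tempered in the IUT
corpus ([EtTh], [IUTchI] "`Π_v := Π^tp_{X_v}`") is built:

* `BTemp Π` — the category `B^temp(Π)` of countable discrete sets with a continuous `Π`-action
  (p. 33), realised as the full subcategory of Mathlib's `Action (Type u) Π` cut out by
  `temperedAction Π` (countable carrier, open stabilisers = continuity for the discrete topology,
  Mathlib `continuousSMul_iff_stabilizer_isOpen`);
* `IsTempered Π` — Definition 3.1 (i) (p. 33), in the intrinsic form explained below;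
* Remark 3.1.1 "every profinite group is tempered" — PROVED (`IsTempered.of_profinite`);
* Remark 3.1.2 — PROVED: open subgroups of a tempered group have countable index
  (`IsTempered.countable_quotient`), open normal subgroups form a basis of neighbourhoods of `1`
  (`IsTempered.hasBasis_nhds_one`), and `Π/H` is an object of `B^temp(Π)` iff `H` is open
  (`temperedAction_quotient_iff`); the last sentence of Remark 3.1.2 / first of p. 34 "any
  continuous homomorphism `Π → Π'` determines a morphism `B^temp(Π) → B^temp(Π')`" is the functor
  `BTemp.res`; the coset description of `Hom(Π/H₁, Π/H₂)` is the named fact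
  `QuotientHomCosetDescription`;
* Definition 3.4 (ii) (p. 36): relatively temp-slim homomorphisms `IsRelativelyTempSlim`;
  "temp-slim" for a group is literally `IsSlimGroup` of the [FrdI] §0 dictionary
  (`Literature.AlgebraicGeometry.Frobenioids.IsSlimGroup`: centralisers of open subgroups are
  trivial) — we prove the identification `isRelativelyTempSlim_id_iff` instead of re-declaring it.

Design note on Definition 3.1 (i). The printed definition reads: "If `Π` may be written as an
inverse limit of an inverse system of surjections of countable discrete topological groups, then
we shall say that `Π` is tempered." For a topological group this is equivalent to the conjunction
of: (a) the open normal subgroups `N` with `Π/N` countable form a basis of neighbourhoods of `1`;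
(b) `Π` is separated by its open normal subgroups; (c) every compatible family of cosets
`(x_N ∈ Π/N)_N` comes from an element of `Π` — i.e. the canonical map `Π → lim_N Π/N` is a
homeomorphic isomorphism onto the inverse limit of the countable discrete groups `Π/N`
(if `Π = lim Π_i`, the kernels of `Π → Π_i` are such `N`, cofinal among all open normal
subgroups; conversely (a)–(c) exhibit `Π` as `lim_N Π/N`). We take (a)–(c) as the definition,
which avoids quantifying over external inverse systems.

Deliberately NOT in this file: Definition 3.1 (ii)–(iv), Proposition 3.2, Corollary 3.3,
Definition 3.4 (i) and Remarks 3.1.3–3.1.8, 3.2.1, 3.4.1–3.4.2 (temperoids: companion file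
`Temperoids.lean`); Definition 3.5 – Corollary 3.11 (tempered coverings of semi-graphs of
anabelioids and the arithmetic examples: companion files). No statement of the paper is
strengthened; Remark 3.1.7 (quasi-temperoids, Appendix) and Remark 3.1.8 (reference to [Dub])
are bibliographic and are not typed.
-/

open CategoryTheory Topology Filter

namespace Literature.AnabelianGeometry.SemiGraphs

universe u

/-! ### The category `B^temp(Π)` (p. 33) -/

section BTemp

variable (G : Type u) [Group G] [TopologicalSpace G]

/-- The objects of `B^temp(Π)` inside Mathlib's category `Action (Type u) Π` of `Π`-sets:
"countable [i.e., of cardinality `≤` the cardinality of the set of natural numbers], discrete sets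
equipped with a continuous `Π`-action" (SemiAnbd §3 p. 33). Continuity of an action on a
discrete set is the openness of every stabiliser (Mathlib `continuousSMul_iff_stabilizer_isOpen`),
which is how we record it. [cite: MochizukiSemiAnbd2006, §3 p.33] -/
def temperedAction : ObjectProperty (Action (Type u) G) := fun X =>
  Countable X.V ∧ ∀ x : X.V, IsOpen {g : G | X.ρ g x = x}

/-- `B^temp(Π)`: "the category whose objects are countable, discrete sets equipped with a
continuous `Π`-action and whose morphisms are morphisms of `Π`-sets" (SemiAnbd §3 p. 33), as the
full subcategory of `Action (Type u) Π` on `temperedAction Π`.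
[cite: MochizukiSemiAnbd2006, §3 p.33] -/
abbrev BTemp := (temperedAction G).FullSubcategory

variable {G} in
/-- The two defining conditions of an object of `B^temp(Π)`, unfolded.
[cite: MochizukiSemiAnbd2006, §3 p.33] -/
theorem temperedAction_iff (X : Action (Type u) G) :
    temperedAction G X ↔ Countable X.V ∧ ∀ x : X.V, IsOpen {g : G | X.ρ g x = x} :=
  Iff.rfl

end BTemp

/-! ### Definition 3.1 (i): tempered topological groups (p. 33) -/

section Tempered

variable (G : Type u) [Group G] [TopologicalSpace G]

/-- **Definition 3.1 (i)** (SemiAnbd §3 p. 33): a topological group `Π` is *tempered* if it "may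
be written as an inverse limit of an inverse system of surjections of countable discrete
topological groups". Recorded intrinsically (see the module docstring for the equivalence):
(a) `basis` — the open normal subgroups of countable index form a basis of neighbourhoods of
`1`; (b) `separated` — open normal subgroups separate points; (c) `complete` — every family of
cosets `x_N ∈ Π/N`, `N` ranging over the open normal subgroups, that is compatible (a
representative of `x_N` represents `x_M` whenever `N ≤ M`) is the family of cosets of one
element. Together: `Π → lim_N Π/N` is an isomorphism of topological groups onto an inverse
limit of countable discrete groups. [cite: MochizukiSemiAnbd2006, Def 3.1(i) p.33] -/
@[mk_iff] structure IsTempered : Prop where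
  /-- open normal subgroups of countable index form a basis of neighbourhoods of the identity -/
  basis : ∀ U ∈ 𝓝 (1 : G), ∃ N : OpenNormalSubgroup G,
    Countable (G ⧸ N.toSubgroup) ∧ (N : Set G) ⊆ U
  /-- open normal subgroups separate points -/
  separated : ∀ g : G, g ≠ 1 → ∃ N : OpenNormalSubgroup G, g ∉ (N : Set G)
  /-- compatible families of cosets modulo open normal subgroups come from elements -/
  complete : ∀ x : (N : OpenNormalSubgroup G) → G ⧸ N.toSubgroup,
    (∀ N M : OpenNormalSubgroup G, N ≤ M → ∀ g : G,
      x N = (g : G ⧸ N.toSubgroup) → x M = (g : G ⧸ M.toSubgroup)) →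
    ∃ g : G, ∀ N : OpenNormalSubgroup G, x N = (g : G ⧸ N.toSubgroup)

variable {G}

/-- The whole group is an open normal subgroup (used to see that the index poset is nonempty).
[folklore] -/
private def topOpenNormalSubgroup : OpenNormalSubgroup G :=
  { toOpenSubgroup := ⊤, isNormal' := by
      change (⊤ : Subgroup G).Normal
      infer_instance }

/-- **Remark 3.1.1**, first sentence (SemiAnbd §3 p. 33): "every profinite group is tempered" —
here for any compact, totally disconnected topological group. Proof: open normal subgroups form
a basis of neighbourhoods of `1` (Mathlib `ProfiniteGrp.exist_openNormalSubgroup_sub_open_nhds_of_one`)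
and have finite quotients; points are separated because the group is Hausdorff; completeness is
Cantor's intersection theorem applied to the compatible closed cosets.
[cite: MochizukiSemiAnbd2006, Rmk 3.1.1 p.33] -/
theorem IsTempered.of_profinite [IsTopologicalGroup G] [CompactSpace G]
    [TotallyDisconnectedSpace G] : IsTempered G where
  basis U hU := by
    obtain ⟨V, hVU, hVo, h1V⟩ := mem_nhds_iff.mp hU
    obtain ⟨N, hN⟩ := ProfiniteGrp.exist_openNormalSubgroup_sub_open_nhds_of_one hVo h1V
    exact ⟨N, inferInstance, hN.trans hVU⟩
  separated g hg := by
    obtain ⟨N, hN⟩ := ProfiniteGrp.exist_openNormalSubgroup_sub_open_nhds_of_one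
      (isOpen_compl_singleton (x := g)) (by simpa using hg.symm)
    exact ⟨N, fun h => hN h rfl⟩
  complete x hx := by
    classical
    -- the closed cosets `C N = {g | x N = g}`
    set C : OpenNormalSubgroup G → Set G := fun N => {g : G | x N = (g : G ⧸ N.toSubgroup)}
      with hC
    have hne : ∀ N, (C N).Nonempty := fun N => by
      obtain ⟨g, hg⟩ := QuotientGroup.mk_surjective (x N)
      exact ⟨g, hg.symm⟩
    have hclosed : ∀ N, IsClosed (C N) := fun N => by
      obtain ⟨g₀, hg₀⟩ := hne N
      have : C N = (fun g : G => g₀⁻¹ * g) ⁻¹' (N : Set G) := by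
        ext g
        simp only [hC, Set.mem_setOf_eq, Set.mem_preimage]
        rw [hg₀, QuotientGroup.eq]
        rfl
      rw [this]
      exact (N.toOpenSubgroup.isClosed).preimage (by fun_prop)
    have hdir : Directed (· ⊇ ·) C := fun N M =>
      ⟨N ⊓ M, fun g hg => hx _ _ inf_le_left g hg, fun g hg => hx _ _ inf_le_right g hg⟩
    haveI : Nonempty (OpenNormalSubgroup G) := ⟨topOpenNormalSubgroup⟩
    obtain ⟨g, hg⟩ := IsCompact.nonempty_iInter_of_directed_nonempty_isCompact_isClosed C hdir
      hne (fun N => (hclosed N).isCompact) hclosed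
    exact ⟨g, fun N => Set.mem_iInter.mp hg N⟩

variable (G) in
/-- **Remark 3.1.1**, second sentence (SemiAnbd §3 p. 33), named fact: "just as in the case of
profinite groups, if a tempered group may be written as an inverse limit of an inverse system
indexed by a countable set of surjections of countable discrete topological groups, then the
group is countably generated [i.e., generated as a topological group by a countable set of
generators]". In the intrinsic language: if countably many open normal subgroups of countable
index are cofinal in the neighbourhoods of `1`, some countable subset generates a dense subgroup.
[cite: MochizukiSemiAnbd2006, Rmk 3.1.1 p.33] -/
def CountablyGeneratedOfCountableSystem [IsTopologicalGroup G] : Prop :=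
  IsTempered G → ∀ N : ℕ → OpenNormalSubgroup G,
    (∀ n, Countable (G ⧸ (N n).toSubgroup)) → (∀ U ∈ 𝓝 (1 : G), ∃ n, (N n : Set G) ⊆ U) →
    ∃ S : Set G, S.Countable ∧ (Subgroup.closure S).topologicalClosure = ⊤

/-- **Remark 3.1.2** (SemiAnbd §3 p. 33), "the topology of `Π` admits a basis of open normal
subgroups": for a tempered group the open normal subgroups (indeed those of countable index)
form a basis of neighbourhoods of `1`. [cite: MochizukiSemiAnbd2006, Rmk 3.1.2 p.33] -/
theorem IsTempered.hasBasis_nhds_one [ContinuousMul G] (hG : IsTempered G) :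
    (𝓝 (1 : G)).HasBasis (fun N : OpenNormalSubgroup G => Countable (G ⧸ N.toSubgroup))
      (fun N => (N : Set G)) := by
  refine ⟨fun U => ⟨fun hU => ?_, fun ⟨N, _, hNU⟩ => ?_⟩⟩
  · obtain ⟨N, hc, hNU⟩ := hG.basis U hU
    exact ⟨N, hc, hNU⟩
  · exact Filter.mem_of_superset (N.toOpenSubgroup.mem_nhds_one) hNU

/-- **Remark 3.1.2** (SemiAnbd §3 p. 33), "every open subgroup of `Π` is closed and of countable
index in `Π`": the countable-index half (closedness is Mathlib's `Subgroup.isClosed_of_isOpen`,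
valid in any topological group). [cite: MochizukiSemiAnbd2006, Rmk 3.1.2 p.33] -/
theorem IsTempered.countable_quotient (hG : IsTempered G) (H : Subgroup G)
    (hH : IsOpen (H : Set G)) : Countable (G ⧸ H) := by
  obtain ⟨N, hN, hNH⟩ := hG.basis (H : Set G) (hH.mem_nhds H.one_mem)
  have hle : N.toSubgroup ≤ H := fun g hg => hNH hg
  have hsurj : Function.Surjective (Subgroup.quotientMapOfLE hle) := by
    rintro ⟨g⟩
    exact ⟨(g : G ⧸ N.toSubgroup), rfl⟩
  exact hsurj.countable

/-- For an open subgroup `H ⊆ Π` of a topological group, the coset space `Π/H` with its left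
`Π`-action has open stabilisers (the stabiliser of `gH` is `gHg⁻¹`). [folklore] -/
private theorem isOpen_stabilizer_quotient [IsTopologicalGroup G] (H : Subgroup G)
    (hH : IsOpen (H : Set G)) (q : G ⧸ H) :
    IsOpen {g : G | (Action.ofMulAction G (G ⧸ H)).ρ g q = q} := by
  obtain ⟨g₀, rfl⟩ := QuotientGroup.mk_surjective q
  have : {g : G | (Action.ofMulAction G (G ⧸ H)).ρ g (g₀ : G ⧸ H) = (g₀ : G ⧸ H)} =
      (fun g : G => g₀⁻¹ * g * g₀) ⁻¹' (H : Set G) := by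
    ext g
    simp only [Set.mem_setOf_eq, Set.mem_preimage, SetLike.mem_coe]
    change g • (g₀ : G ⧸ H) = (g₀ : G ⧸ H) ↔ _
    rw [MulAction.Quotient.smul_mk, smul_eq_mul, eq_comm, QuotientGroup.eq, mul_assoc]
  rw [this]
  exact hH.preimage (by fun_prop)

/-- **Remark 3.1.2** (SemiAnbd §3 p. 33): "If `H ⊆ Π` is an arbitrary subgroup, then the `Π`-set
`Π/H` forms an object of `B^temp(Π)` if and only if `H` is open" (for `Π` tempered).
[cite: MochizukiSemiAnbd2006, Rmk 3.1.2 p.33] -/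
theorem temperedAction_quotient_iff [IsTopologicalGroup G] (hG : IsTempered G) (H : Subgroup G) :
    temperedAction G (Action.ofMulAction G (G ⧸ H)) ↔ IsOpen (H : Set G) := by
  constructor
  · rintro ⟨-, hstab⟩
    have h1 := hstab ((1 : G) : G ⧸ H)
    have : {g : G | (Action.ofMulAction G (G ⧸ H)).ρ g ((1 : G) : G ⧸ H) = ((1 : G) : G ⧸ H)}
        = (H : Set G) := by
      ext g
      simp only [Set.mem_setOf_eq, SetLike.mem_coe]
      change g • ((1 : G) : G ⧸ H) = ((1 : G) : G ⧸ H) ↔ _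
      rw [MulAction.Quotient.smul_mk, smul_eq_mul, mul_one, QuotientGroup.eq, mul_one, inv_mem_iff]
    rw [this] at h1
    exact h1
  · intro hH
    exact ⟨hG.countable_quotient H hH, isOpen_stabilizer_quotient H hH⟩

variable (G) in
/-- **Remark 3.1.2** (SemiAnbd §3 p. 33), named fact: "If `H₁, H₂ ⊆ Π` are open, then there is a
natural bijection between the morphisms `Π/H₁ → Π/H₂` and the cosets `h · H₂` satisfying
`h⁻¹ · H₁ · h ⊆ H₂`" — the bijection sends a `Π`-map to the image of the coset `1 · H₁`.
[cite: MochizukiSemiAnbd2006, Rmk 3.1.2 p.33] -/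
def QuotientHomCosetDescription : Prop :=
  ∀ (H₁ H₂ : Subgroup G), IsOpen (H₁ : Set G) → IsOpen (H₂ : Set G) →
    Set.BijOn (fun f : Action.ofMulAction G (G ⧸ H₁) ⟶ Action.ofMulAction G (G ⧸ H₂) =>
        f.hom ((1 : G) : G ⧸ H₁))
      Set.univ {q : G ⧸ H₂ | ∃ h : G, q = (h : G ⧸ H₂) ∧ ∀ x ∈ H₁, h⁻¹ * x * h ∈ H₂}

variable (G) in
/-- **Remark 3.1.2** (SemiAnbd §3 pp. 33–34), named fact: "if `T₁, T₂` are objects of a temperoid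
`T`, and `T₁` is connected, then the set `Hom_T(T₁, T₂)` is countable" — stated for
`T = B^temp(Π)` (connected objects in the sense of the [FrdI]/[SemiAnbd] §0 dictionary).
[cite: MochizukiSemiAnbd2006, Rmk 3.1.2 pp.33-34] -/
def CountableHomOfConnected : Prop :=
  IsTempered G → ∀ T₁ T₂ : BTemp G,
    Literature.AlgebraicGeometry.Frobenioids.IsConnectedObj T₁ → Countable (T₁ ⟶ T₂)

end Tempered

/-! ### Functoriality in `Π` (p. 34) and Definition 3.4 (ii) (p. 36) -/

section Functorial

variable {G : Type u} [Group G] [TopologicalSpace G] {H : Type u} [Group H] [TopologicalSpace H]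

/-- SemiAnbd §3 pp. 33–34: "if `Π'` is also tempered, then any continuous homomorphism `Π → Π'`
determines [by composing the action of `Π'` on a `Π'`-set with this homomorphism so as to
obtain a `Π`-set] a morphism of connected temperoids `B^temp(Π) → B^temp(Π')`", i.e. the
pull-back functor `B^temp(Π') ⥤ B^temp(Π)` (restriction of scalars; countability is preserved and
stabilisers stay open by continuity). [cite: MochizukiSemiAnbd2006, Rmk 3.1.2 pp.33-34] -/
def BTemp.res (φ : G →ₜ* H) : BTemp H ⥤ BTemp G :=
  ObjectProperty.lift _ (ObjectProperty.ι _ ⋙ Action.res (Type u) φ.toMonoidHom) fun X =>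
    ⟨X.property.1, fun x => (X.property.2 x).preimage φ.continuous⟩

/-- **Definition 3.4 (ii)** (SemiAnbd §3 p. 36): a continuous homomorphism of tempered groups
`Π₁ → Π₂` is *relatively temp-slim* "if, for every open subgroup `H ⊆ Π₁`, the centralizer
`Z_{Π₂}(Im(H))` is trivial". [cite: MochizukiSemiAnbd2006, Def 3.4(ii) p.36] -/
@[mk_iff] structure IsRelativelyTempSlim (φ : G →ₜ* H) : Prop where
  /-- centralisers in `Π₂` of images of open subgroups of `Π₁` are trivial -/
  centralizer_eq_bot : ∀ U : Subgroup G, IsOpen (U : Set G) →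
    Subgroup.centralizer ((U.map φ.toMonoidHom : Subgroup H) : Set H) = ⊥

/-- **Definition 3.4 (ii)** (SemiAnbd §3 p. 36): "A tempered group will be called *temp-slim* if
its identity morphism is relatively temp-slim" — which is literally the slimness condition of the
§0 dictionaries (`IsSlimGroup`: every open subgroup has trivial centraliser), so temp-slim groups
are recorded as `IsSlimGroup` and this lemma is the bridge.
[cite: MochizukiSemiAnbd2006, Def 3.4(ii) p.36] -/
theorem isRelativelyTempSlim_id_iff :
    IsRelativelyTempSlim (ContinuousMonoidHom.id G) ↔
      Literature.AlgebraicGeometry.Frobenioids.IsSlimGroup G := by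
  rw [isRelativelyTempSlim_iff, Literature.AlgebraicGeometry.Frobenioids.isSlimGroup_iff]
  refine forall_congr' fun U => forall_congr' fun _ => ?_
  have : (U.map (ContinuousMonoidHom.id G).toMonoidHom : Subgroup G) = U := by
    ext g
    simp only [Subgroup.mem_map]
    constructor
    · rintro ⟨x, hx, rfl⟩; exact hx
    · intro hg; exact ⟨g, hg, rfl⟩
  rw [this]

end Functorial

end Literature.AnabelianGeometry.SemiGraphs
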